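import Summits.QuantumFields.QCD.Theorems.NestedDissectionSeaLightQuarkCompletionJumpGermGlue

/-!
# Crux `LightQuarkCompletion` (stmt-QuantumFields-18066) — line `Sketch`, stub `stub_jumpGerm` (B2a), wave c2:
# the by-name reduction hunt is NEGATIVE; the stub is EXACTLY "band pins along a subsequence" for the given `reg`

Worker file (stub-worker B2a, wave c2, 2026-08-17).  Sorry-free.  No definition; nothing asserts a Theses decl.

Hunt result.  The two pin clauses (`CoerciveSeaNegative.PinClause` (b), `EarlyCrosserLawNegative.UpperPin` (b″)) occur in
the tree ONLY inside `Theses/NestedDissectionSea.lean`: as CONCLUSIONS of the `∃ reg` items `NegativeCellsDilute` (13900, (b)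
only), `EarlyCrosserLaw` (13995), `CoerciveSea` (13901, (b) only), `SeaFactorisationBridge` (17010), and as HYPOTHESES of the
`∀ reg` items `FrameAndSeparatorLaw` (17012) and `LightQuarkCompletion` (18066) itself; every registered stub of the lines of
13995 / 13900 / 13901 / 17010 is either `∃ reg` (`stub_pinnedLine`, `stub_pinnedLineOnBranch`, `stub_twoSidedPin`,
`stub_twoSidedParityPin`, `stub_pinnedPhysicalLine`, `stub_pinnedDilutionOnPhysicalBranch`), about a NAMED regularisation
(`lineReg Nf T`: `stub_signLocality`, `stub_quasiProduct`, `stub_blockParityFloor`, `stub_uvEarlyCrossers`), CONSUMES the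
pins of the given `reg` (`pins_force_window_crossing`, `stub_meanCountLaw`, `stub_pseudospectralCoverLaw`,
`stub_diluteOfActionFloor`, `stub_separatorLawLarge`, 17012's `Frame`), or derives ONE pin of the given `reg` AT ITS OWN
THRESHOLD from a further hypothesis about that `reg` which nothing supplies (`stub_pinOfNearHalfResampling`: (b) ⇐ near-half
resampling; `upperPin_of_torusEarlyRarity`: (b″) ⇐ early-torus-crosser rarity).  No other route (IntegerCriticalLine, WilsonQuarkChessboard,
SpectralDefectExtinction, PauliWegnerSea, SeaNonGibbs, WilsonMobilityGap, …) types a phase-quenched sign probability of a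
GIVEN regularisation (their sign statements are `∃ reg` or deterministic witnesses `∃ U, Re det < 0`).  Hence NO decl
`X : Prop` of the tree yields, for the given threshold `reg`, either the band lower pin or pins at a germ along a subsequence.

What this file certifies instead (so that the missing fact can be quoted without slack):

* `zeroPin_recentre_iff` — the converse of the landed `zeroPin_recentre_of`: the zero-threshold two-sided pin of `reg₁`
  re-centred at `J` (weights at the positive tuple `m`, radius `R`) is EQUIVALENT to the lower pin of `reg₁` from depth `−J`
  and the upper pin of `reg₁` from height `J`, weights at `J + m`, same `R` (transport both ways, `pinClause_transport` /
  `upperPin_transport` with `c = ∓J`).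
* `jumpGerm_iff_bandPinsAlong` — hence, for a given `reg`, the conclusion of `stub_jumpGerm` is EQUIVALENT to
  "BAND PINS ALONG A SUBSEQUENCE": `∃ φ ↑, ∃ J, ∀ m > 0, ∃ R > 0, PinClause Nf (reg.restrict φ _) (−J) (J + m) R ∧
  UpperPin Nf (reg.restrict φ _) J (J + m) R` — EarlyCrosserLaw's (b),(b″) at zero threshold relative to the germ `J`, read
  along the GIVEN regularisation (weights at every sea tuple above `J·1`, including the light ones in `(J, M₀]`).
* `stub_jumpGerm_of_bandPinsAlong` — the registered signature of `stub_jumpGerm`, verbatim, from that statement in `∀ reg`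
  form (the MISSING FACT, no tree decl; it is the planner's foreseen `JumpBandSharp` half of child `ZeroThresholdDescent`).
-/

noncomputable section

namespace Summit.QuantumFields.QCD.Theorems.LightQuarkJumpLine

open MeasureTheory Filter Topology
open Literature.MathematicalPhysics.QuantumFieldTheory Literature.MathematicalPhysics.QuantumLattice
  Literature.Probability.LatticeModels
open Summit.QuantumFields.QCD.Theorems.CoerciveSeaNegative (PinClause tendsto_a_div_Zm massExponent_pos)
open Summit.QuantumFields.QCD.Theorems.EarlyCrosserLawNegative (UpperPin)

/-! ## The zero-threshold pin of a re-centring, read BOTH ways -/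

section Recentre

variable {Nf : ℕ} (reg₁ : QCDRegularisation Nf) (J : ℝ)

/-- **Un-re-centring the lower pin.**  The zero-threshold lower pin of `reg₁` re-centred at `J` (weights at `m`) gives
back the lower pin of `reg₁` from depth `−J` with weights at `J + m` (transport with `c = −J`). [folklore] -/
theorem pinClause_of_recentre {m : Fin Nf → ℝ} {R : ℝ}
    (h : PinClause Nf (QCDRegularisation.mk reg₁.a reg₁.a_pos reg₁.tendsto_a reg₁.β reg₁.L reg₁.tendsto_L
        (fun k => reg₁.mcrit k + reg₁.a k * J / reg₁.Zm k) reg₁.Zm reg₁.Zm_pos) 0 m R) :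
    PinClause Nf reg₁ (-J) (fun f => J + m f) R := by
  refine pinClause_transport h (-J) (fun _ => rfl) (fun _ => rfl) (fun k f => ?_) (fun k M => ?_) (by linarith)
  · show reg₁.mcrit k + reg₁.a k * (J + m f) / reg₁.Zm k =
      reg₁.mcrit k + reg₁.a k * J / reg₁.Zm k + reg₁.a k * m f / reg₁.Zm k
    ring
  · show reg₁.mcrit k - reg₁.a k * M / reg₁.Zm k =
      reg₁.mcrit k + reg₁.a k * J / reg₁.Zm k - reg₁.a k * (M - -J) / reg₁.Zm k
    ring

/-- **Un-re-centring the upper pin** (transport with `c = −J`). [folklore] -/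
theorem upperPin_of_recentre {m : Fin Nf → ℝ} {R : ℝ}
    (h : UpperPin Nf (QCDRegularisation.mk reg₁.a reg₁.a_pos reg₁.tendsto_a reg₁.β reg₁.L reg₁.tendsto_L
        (fun k => reg₁.mcrit k + reg₁.a k * J / reg₁.Zm k) reg₁.Zm reg₁.Zm_pos) 0 m R) :
    UpperPin Nf reg₁ J (fun f => J + m f) R := by
  refine upperPin_transport h (-J) (fun _ => rfl) (fun _ => rfl) (fun k f => ?_) (fun k M => ?_) (by linarith)
  · show reg₁.mcrit k + reg₁.a k * (J + m f) / reg₁.Zm k =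
      reg₁.mcrit k + reg₁.a k * J / reg₁.Zm k + reg₁.a k * m f / reg₁.Zm k
    ring
  · show reg₁.mcrit k + reg₁.a k * M / reg₁.Zm k =
      reg₁.mcrit k + reg₁.a k * J / reg₁.Zm k + reg₁.a k * (M + -J) / reg₁.Zm k
    ring

/-- **Re-centring at `J` is lossless.**  The zero-threshold two-sided pin of `reg₁` re-centred at the germ `J` (weights at
the positive tuple `m`, radius `R`) holds IFF `reg₁` carries the lower pin from depth `−J` and the upper pin from height `J`,
both with weights at `J + m` and the same radius `R`. [folklore] -/
theorem zeroPin_recentre_iff {m : Fin Nf → ℝ} {R : ℝ} :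
    (PinClause Nf (QCDRegularisation.mk reg₁.a reg₁.a_pos reg₁.tendsto_a reg₁.β reg₁.L reg₁.tendsto_L
        (fun k => reg₁.mcrit k + reg₁.a k * J / reg₁.Zm k) reg₁.Zm reg₁.Zm_pos) 0 m R ∧
      UpperPin Nf (QCDRegularisation.mk reg₁.a reg₁.a_pos reg₁.tendsto_a reg₁.β reg₁.L reg₁.tendsto_L
        (fun k => reg₁.mcrit k + reg₁.a k * J / reg₁.Zm k) reg₁.Zm reg₁.Zm_pos) 0 m R) ↔
    (PinClause Nf reg₁ (-J) (fun f => J + m f) R ∧ UpperPin Nf reg₁ J (fun f => J + m f) R) :=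
  ⟨fun h => ⟨pinClause_of_recentre reg₁ J h.1, upperPin_of_recentre reg₁ J h.2⟩,
    fun h => zeroPin_recentre_of reg₁ J h.1 h.2⟩

end Recentre

/-! ## The stub's conclusion IS "band pins along a subsequence" -/

/-- **The conclusion of `stub_jumpGerm` in un-re-centred coordinates** (for a given `reg`): some subsequence `φ` and germ
`J` carry the zero-threshold two-sided pin of the reindexed, re-centred regularisation at every positive tuple IFF some
subsequence `φ` and germ `J` carry, at every positive tuple `m`, the lower pin of `reg.restrict φ` from depth `−J` and its
upper pin from height `J`, weights at `J + m`, on a common radius. [folklore] -/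
theorem jumpGerm_iff_bandPinsAlong {Nf : ℕ} (reg : QCDRegularisation Nf) :
    (∃ (φ : ℕ → ℕ) (hφ : StrictMono φ) (J : ℝ), ∀ m : Fin Nf → ℝ, (∀ f, 0 < m f) → ∃ R : ℝ, 0 < R ∧
      PinClause Nf (QCDRegularisation.mk (reg.restrict φ hφ.tendsto_atTop).a (reg.restrict φ hφ.tendsto_atTop).a_pos
        (reg.restrict φ hφ.tendsto_atTop).tendsto_a (reg.restrict φ hφ.tendsto_atTop).β (reg.restrict φ hφ.tendsto_atTop).L
        (reg.restrict φ hφ.tendsto_atTop).tendsto_L (fun k => (reg.restrict φ hφ.tendsto_atTop).mcrit k +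
          (reg.restrict φ hφ.tendsto_atTop).a k * J / (reg.restrict φ hφ.tendsto_atTop).Zm k)
        (reg.restrict φ hφ.tendsto_atTop).Zm (reg.restrict φ hφ.tendsto_atTop).Zm_pos) 0 m R ∧
      UpperPin Nf (QCDRegularisation.mk (reg.restrict φ hφ.tendsto_atTop).a (reg.restrict φ hφ.tendsto_atTop).a_pos
        (reg.restrict φ hφ.tendsto_atTop).tendsto_a (reg.restrict φ hφ.tendsto_atTop).β (reg.restrict φ hφ.tendsto_atTop).L
        (reg.restrict φ hφ.tendsto_atTop).tendsto_L (fun k => (reg.restrict φ hφ.tendsto_atTop).mcrit k +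
          (reg.restrict φ hφ.tendsto_atTop).a k * J / (reg.restrict φ hφ.tendsto_atTop).Zm k)
        (reg.restrict φ hφ.tendsto_atTop).Zm (reg.restrict φ hφ.tendsto_atTop).Zm_pos) 0 m R) ↔
    (∃ (φ : ℕ → ℕ) (hφ : StrictMono φ) (J : ℝ), ∀ m : Fin Nf → ℝ, (∀ f, 0 < m f) → ∃ R : ℝ, 0 < R ∧
      PinClause Nf (reg.restrict φ hφ.tendsto_atTop) (-J) (fun f => J + m f) R ∧
      UpperPin Nf (reg.restrict φ hφ.tendsto_atTop) J (fun f => J + m f) R) := by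
  constructor
  · rintro ⟨φ, hφ, J, h⟩
    refine ⟨φ, hφ, J, fun m hm => ?_⟩
    obtain ⟨R, hR, hpin⟩ := h m hm
    exact ⟨R, hR, (zeroPin_recentre_iff (reg.restrict φ hφ.tendsto_atTop) J).1 hpin⟩
  · rintro ⟨φ, hφ, J, h⟩
    refine ⟨φ, hφ, J, fun m hm => ?_⟩
    obtain ⟨R, hR, hb, hu⟩ := h m hm
    exact ⟨R, hR, zeroPin_recentre_of (reg.restrict φ hφ.tendsto_atTop) J hb hu⟩

/-! ## B2a from the missing fact: band pins along a subsequence for the GIVEN threshold regularisation -/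

/-- **`stub_jumpGerm` ⇐ BAND PINS ALONG A SUBSEQUENCE** (the missing fact, in `∀ reg` form; no tree decl supplies it).
If every threshold regularisation of `N_f ∈ {2,3}` (both scalings, weak branch, two-sided pin and body above `M₀ ≥ 0`)
carries, along SOME subsequence `φ` and at SOME germ `J`, for every positive tuple `m` a common radius `R > 0` with the lower
pin from depth `−J` and the upper pin from height `J` (weights at `J + m`) — EarlyCrosserLaw (b),(b″) at zero threshold
relative to the germ, read along the GIVEN regularisation — then `stub_jumpGerm` holds verbatim (re-centre at `J`,
`zeroPin_recentre_of`).  By `jumpGerm_iff_bandPinsAlong` the hypothesis is not stronger than the stub. -/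
theorem stub_jumpGerm_of_bandPinsAlong
    (h : ∀ Nf : ℕ, (Nf = 2 ∨ Nf = 3) → ∀ reg : QCDRegularisation Nf, reg.HasMassScaling →
      (reg.scheme 0 0 0).HasAsymptoticScaling → (∀ᶠ k : ℕ in atTop, -1 ≤ reg.mcrit k) → ∀ M₀ : ℝ, 0 ≤ M₀ →
      (∀ m : Fin Nf → ℝ, (∀ f, M₀ < m f) → ∃ R : ℝ, 0 < R ∧ PinClause Nf reg M₀ m R ∧ UpperPin Nf reg M₀ m R) →
      (∀ m : Fin Nf → ℝ, (∀ f, M₀ < m f) → ∃ (z shift : QCDField Nf → ℕ → ℝ) (T : OSData (QCDField Nf) 4),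
        IsQCDAlong (reg.scheme m z shift) T ∧ T.IsNontrivial QCDField.glue ∧ T.IsNonGaussian QCDField.glue ∧
          (∀ f g : Fin Nf, f ≠ g → T.IsNontrivial (QCDField.pseudoRe f g)) ∧
            ∃ Δ > 0, T.HasMassGap Δ ∧ (reg.scheme m z shift).HasLatticeMassGap Δ) →
      ∃ (φ : ℕ → ℕ) (hφ : StrictMono φ) (J : ℝ), ∀ m : Fin Nf → ℝ, (∀ f, 0 < m f) → ∃ R : ℝ, 0 < R ∧
        PinClause Nf (reg.restrict φ hφ.tendsto_atTop) (-J) (fun f => J + m f) R ∧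
        UpperPin Nf (reg.restrict φ hφ.tendsto_atTop) J (fun f => J + m f) R) :
    ∀ Nf : ℕ, (Nf = 2 ∨ Nf = 3) → ∀ reg : QCDRegularisation Nf, reg.HasMassScaling →
    (reg.scheme 0 0 0).HasAsymptoticScaling → (∀ᶠ k : ℕ in atTop, -1 ≤ reg.mcrit k) → ∀ M₀ : ℝ, 0 ≤ M₀ →
    (∀ m : Fin Nf → ℝ, (∀ f, M₀ < m f) → ∃ R : ℝ, 0 < R ∧ PinClause Nf reg M₀ m R ∧ UpperPin Nf reg M₀ m R) →
    (∀ m : Fin Nf → ℝ, (∀ f, M₀ < m f) → ∃ (z shift : QCDField Nf → ℕ → ℝ) (T : OSData (QCDField Nf) 4),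
      IsQCDAlong (reg.scheme m z shift) T ∧ T.IsNontrivial QCDField.glue ∧ T.IsNonGaussian QCDField.glue ∧
        (∀ f g : Fin Nf, f ≠ g → T.IsNontrivial (QCDField.pseudoRe f g)) ∧
          ∃ Δ > 0, T.HasMassGap Δ ∧ (reg.scheme m z shift).HasLatticeMassGap Δ) →
    ∃ (φ : ℕ → ℕ) (hφ : StrictMono φ) (J : ℝ), ∀ m : Fin Nf → ℝ, (∀ f, 0 < m f) → ∃ R : ℝ, 0 < R ∧
      PinClause Nf (QCDRegularisation.mk (reg.restrict φ hφ.tendsto_atTop).a (reg.restrict φ hφ.tendsto_atTop).a_pos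
        (reg.restrict φ hφ.tendsto_atTop).tendsto_a (reg.restrict φ hφ.tendsto_atTop).β (reg.restrict φ hφ.tendsto_atTop).L
        (reg.restrict φ hφ.tendsto_atTop).tendsto_L (fun k => (reg.restrict φ hφ.tendsto_atTop).mcrit k +
          (reg.restrict φ hφ.tendsto_atTop).a k * J / (reg.restrict φ hφ.tendsto_atTop).Zm k)
        (reg.restrict φ hφ.tendsto_atTop).Zm (reg.restrict φ hφ.tendsto_atTop).Zm_pos) 0 m R ∧
      UpperPin Nf (QCDRegularisation.mk (reg.restrict φ hφ.tendsto_atTop).a (reg.restrict φ hφ.tendsto_atTop).a_pos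
        (reg.restrict φ hφ.tendsto_atTop).tendsto_a (reg.restrict φ hφ.tendsto_atTop).β (reg.restrict φ hφ.tendsto_atTop).L
        (reg.restrict φ hφ.tendsto_atTop).tendsto_L (fun k => (reg.restrict φ hφ.tendsto_atTop).mcrit k +
          (reg.restrict φ hφ.tendsto_atTop).a k * J / (reg.restrict φ hφ.tendsto_atTop).Zm k)
        (reg.restrict φ hφ.tendsto_atTop).Zm (reg.restrict φ hφ.tendsto_atTop).Zm_pos) 0 m R := by
  intro Nf hNf reg hMS hAS hbr M₀ hM₀ hpin hbody
  exact (jumpGerm_iff_bandPinsAlong reg).2 (h Nf hNf reg hMS hAS hbr M₀ hM₀ hpin hbody)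

end Summit.QuantumFields.QCD.Theorems.LightQuarkJumpLine

end
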